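import Summits.HodgeConjecture.HodgeConjecture.Theses.HeckePrymWeil

/-!
# `WeilTwelvefoldsSqrtMinus7` (stmt-HodgeConjecture-1261) · Negative · the amnesic theta-monad's moment system

Negative-side knowledge for the crux `HeckePrymWeil.WeilTwelvefoldsSqrtMinus7`, from the standing disprover's
work file `Cruxes/WeilTwelvefoldsSqrtMinus7/Disproof.lean` §11d (refuter-cdisprove-stmt-HodgeConjecture-1261-g4-0,
cycle 4, 2026-08-16).  It concerns the MECHANISM behind stub S1 `stub_hyperbolicFourteenfolds` of the registered
line `Cruxes/WeilTwelvefoldsSqrtMinus7/Lines/amnesic-secant-sheaves-split-fourteenfolds.lean` and its idea card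
`Ideas/amnesic-secant-sheaves-split-fourteenfolds.md`, which bets on ONE "amnesic" semiregular `K`-secant object
realised as a THETA-MONAD `0 → ⊕𝒪(m₁Θ)^{a₁} → ⋯ → ⊕𝒪(m₈Θ)^{a₈} → 0` on a ppav 7-fold with `ch ∈ P_α`,
`α = (1+√-7)/2`, and displays the candidate "rank 2, `c(F) = 1 + Θ + 2Θ²`, `ch = e^{αΘ} + e^{ᾱΘ}`, moments
`(2, 1, -3, -5, 1, 11, 9, -13)`; any `≥ 8` integral slopes solve the moment system by Vandermonde".

FINDING.  Vandermonde solves the moment system over `ℚ`, not `ℤ`.  A complex of direct sums of theta-powers has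
`ch = Σ_m n_m e^{mθ}` with integer net multiplicities, so its binomial moments `Σ_m n_m C(m,k)` are integers; for
the class `c·e^{αθ} + c̄·e^{ᾱθ}` they are `Tr_{K/ℚ}(c·C(α,k))`, and `Tr C(α,4) = Tr((α-1)/3) = -1/3`.  Hence:

* `no_thetaComplex_with_unit_secant_moments` : no finite complex of direct sums of theta-powers on a ppav of
  dimension `≥ 4` has the moments `(·, 1, -3, -5, 1, …)` — the card's rank-2 instance does not exist
  (`Σ n_m·m(m-1)(m-2)(m-3) = 1 + 30 - 33 - 6 = -8`, each term divisible by `24`,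
  `twentyfour_dvd_fallingFactorial_four`); consistent with Markman's dimension 3, where the conditions stop at
  `k = 3` and hold;
* `thetaComplex_secant_rank_dvd_fortyfive` : on a ppav of dimension `≥ 6`, every theta-complex whose moment vector
  lies in `P_α` (secant recurrence `M_{i+2} = M_{i+1} - 2M_i`) has `45 ∣ rank` (binomial moments `k = 5, 6`:
  `120·B₅ = 16M₀ - 32M₁`, `720·B₆ = 144M₁ - 16M₀`); `thetaComplex_secant_rank_dvd_three` : dimension `≥ 4` gives `3 ∣ rank`;
* `thetaComplex_rank45_moments`, `rank45_moments_are_secant` : the smallest theta-realizable secant class on a ppav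
  7-fold has rank `45` (`c = 45α`; the admissible `c` form `45·ℤ[α]`, reproducible rational arithmetic attached to
  the item as `theta_moments.py/.out`): slopes `-3,…,3`, net multiplicities `(-4, 42, -210, 560, -420, 84, -7)`,
  moments `(45, -135, -225, 45, 495, 405, -585, -1395) = (Tr 45α^{i+1})_i`.

Consequence for the line (the crux and S1 stay implied by the Hodge conjecture): an honest amnesic theta-monad has
`|rank| ∈ 45ℤ_{>0}` and hundreds of line-bundle summands, so the card's budget "simple, `dim Ext²(F,F)^G = 42`"
must be met at that size (the `E₁` page of the `Ext(F,F)` spectral sequence of the rank-45 complex has total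
dimension `542985`, `12036759`, `81426555` in degrees `0, 1, 2`; `χ(F,F) = 0` for every secant class), or the object must leave the theta lattice
(`μ_r`-twisted or curve-built, both excluded by the card for `F`).
-/

set_option linter.dupNamespace false

namespace Summit.HodgeConjecture.HodgeConjecture.Theorems.WeilTwelvefoldsSqrtMinus7.Negative

section AmnesicMoments

/-- `24 ∣ m(m-1)(m-2)(m-3) = m⁴ - 6m³ + 11m² - 6m` for every integer `m` (`= 24·C(m,4)`). [folklore] -/
theorem twentyfour_dvd_fallingFactorial_four (m : ℤ) : (24 : ℤ) ∣ m ^ 4 - 6 * m ^ 3 + 11 * m ^ 2 - 6 * m := by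
  have h : ∀ x : ZMod 24, x ^ 4 - 6 * x ^ 3 + 11 * x ^ 2 - 6 * x = 0 := by decide
  have h' : ((m ^ 4 - 6 * m ^ 3 + 11 * m ^ 2 - 6 * m : ℤ) : ZMod 24) = 0 := by
    push_cast
    exact h m
  exact_mod_cast (ZMod.intCast_zmod_eq_zero_iff_dvd _ 24).1 h'

/-- **No theta-complex has the unit secant moments** (refutes the amnesic card's displayed rank-2 instance).
If integers `n_m` (net multiplicity of `𝒪(mΘ)` in a finite complex of direct sums of theta-powers on a ppav of
dimension `≥ 4`, `ch = Σ_m n_m e^{mθ}`) had the moments `Σ n_m m = 1`, `Σ n_m m² = -3`, `Σ n_m m³ = -5`,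
`Σ n_m m⁴ = 1` of the class `e^{αθ} + e^{ᾱθ}`, `α = (1+√-7)/2` (the card's `(2, 1, -3, -5, 1, 11, 9, -13)`),
then `Σ_m n_m·m(m-1)(m-2)(m-3) = 1 + 30 - 33 - 6 = -8`, but every term is divisible by `24`.  Equivalently
`Tr C(α,4) = -1/3 ∉ ℤ`.  Valid for any finite slope set `s`, any number of slopes. [folklore] -/
theorem no_thetaComplex_with_unit_secant_moments (s : Finset ℤ) (n : ℤ → ℤ)
    (h1 : ∑ m ∈ s, n m * m = 1) (h2 : ∑ m ∈ s, n m * m ^ 2 = -3)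
    (h3 : ∑ m ∈ s, n m * m ^ 3 = -5) (h4 : ∑ m ∈ s, n m * m ^ 4 = 1) : False := by
  have key : ∑ m ∈ s, n m * (m ^ 4 - 6 * m ^ 3 + 11 * m ^ 2 - 6 * m) = -8 := by
    have hsplit : ∑ m ∈ s, n m * (m ^ 4 - 6 * m ^ 3 + 11 * m ^ 2 - 6 * m) =
        (∑ m ∈ s, n m * m ^ 4) - 6 * (∑ m ∈ s, n m * m ^ 3) + 11 * (∑ m ∈ s, n m * m ^ 2) -
          6 * (∑ m ∈ s, n m * m) := by
      rw [Finset.mul_sum, Finset.mul_sum, Finset.mul_sum, ← Finset.sum_sub_distrib,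
        ← Finset.sum_add_distrib, ← Finset.sum_sub_distrib]
      exact Finset.sum_congr rfl fun m _ => by ring
    rw [hsplit, h1, h2, h3, h4]
    norm_num
  have hdvd : (24 : ℤ) ∣ ∑ m ∈ s, n m * (m ^ 4 - 6 * m ^ 3 + 11 * m ^ 2 - 6 * m) :=
    Finset.dvd_sum fun m _ => Dvd.dvd.mul_left (twentyfour_dvd_fallingFactorial_four m) _
  rw [key] at hdvd
  omega

/-- The smallest theta-realizable secant class on a ppav 7-fold, `c = 45α` (rank `45`): the net multiplicities
`(-4, 42, -210, 560, -420, 84, -7)` over the slopes `-3, …, 3` have EXACTLY the moments `Tr(45·α^{i+1})`,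
`i = 0..7`, namely `(45, -135, -225, 45, 495, 405, -585, -1395)` (kernel arithmetic; the corrected starting point
for the card's `Ext²` enumeration). [folklore] -/
theorem thetaComplex_rank45_moments :
    (let n : ℤ → ℤ := fun m => if m = -3 then -4 else if m = -2 then 42 else if m = -1 then -210
      else if m = 0 then 560 else if m = 1 then -420 else if m = 2 then 84 else if m = 3 then -7 else 0
    let s : List ℤ := [-3, -2, -1, 0, 1, 2, 3]
    (List.map (fun i : ℕ => (s.map fun m => n m * m ^ i).sum) (List.range 8))) =
      [45, -135, -225, 45, 495, 405, -585, -1395] := by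
  decide

/-- … and these ARE the moments of `45α·e^{αθ} + 45ᾱ·e^{ᾱθ}`: with `ω = 1 + √-7 = 2α`,
`Tr(45 α^{i+1}) = 45·Re(ω^{i+1})/2^{i}`; checked through `2^{i}·M_i = 45·2·re(ω^{i+1})/2 = 45·re(ω^{i+1})`
for `i = 0..7` in `ℤ[√-7]`. [folklore] -/
theorem rank45_moments_are_secant :
    (List.map (fun i : ℕ => (45 : ℤ) * ((⟨1, 1⟩ : ℤ√(-7)) ^ (i + 1)).re) (List.range 8)) =
      (List.map (fun p : ℤ × ℕ => p.1 * 2 ^ p.2)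
        [((45 : ℤ), 0), (-135, 1), (-225, 2), (45, 3), (495, 4), (405, 5), (-585, 6), (-1395, 7)]) := by
  decide

set_option maxRecDepth 100000 in
/-- `120 ∣ m(m-1)(m-2)(m-3)(m-4)` (`= 120·C(m,5)`). [folklore] -/
theorem fallingFactorial_five_dvd (m : ℤ) :
    (120 : ℤ) ∣ m ^ 5 - 10 * m ^ 4 + 35 * m ^ 3 - 50 * m ^ 2 + 24 * m := by
  have h : ∀ x : ZMod 120, x ^ 5 - 10 * x ^ 4 + 35 * x ^ 3 - 50 * x ^ 2 + 24 * x = 0 := by decide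
  have h' : ((m ^ 5 - 10 * m ^ 4 + 35 * m ^ 3 - 50 * m ^ 2 + 24 * m : ℤ) : ZMod 120) = 0 := by
    push_cast
    exact h m
  exact_mod_cast (ZMod.intCast_zmod_eq_zero_iff_dvd _ 120).1 h'

set_option maxRecDepth 200000 in
/-- `720 ∣ m(m-1)⋯(m-5)` (`= 720·C(m,6)`). [folklore] -/
theorem fallingFactorial_six_dvd (m : ℤ) :
    (720 : ℤ) ∣ m ^ 6 - 15 * m ^ 5 + 85 * m ^ 4 - 225 * m ^ 3 + 274 * m ^ 2 - 120 * m := by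
  have h : ∀ x : ZMod 720, x ^ 6 - 15 * x ^ 5 + 85 * x ^ 4 - 225 * x ^ 3 + 274 * x ^ 2 - 120 * x = 0 := by
    decide
  have h' : ((m ^ 6 - 15 * m ^ 5 + 85 * m ^ 4 - 225 * m ^ 3 + 274 * m ^ 2 - 120 * m : ℤ) : ZMod 720) = 0 := by
    push_cast
    exact h m
  exact_mod_cast (ZMod.intCast_zmod_eq_zero_iff_dvd _ 720).1 h'

/-- **Theta-complexes in the secant plane `P_α` have rank divisible by `45`** (ppav of dimension `≥ 6`).
Let `M_i = Σ_m n_m mⁱ` (`i ≤ 6`) be the moments of a finite complex of direct sums of theta-powers, and suppose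
they satisfy the secant recurrence `M_{i+2} = M_{i+1} - 2M_i` (`i ≤ 4`) — i.e. `(M_i)` are the moments
`Tr(c·αⁱ)` of a rational point `c·e^{αθ} + c̄·e^{ᾱθ}` of `P_α`, `α² = α - 2`, `α = (1+√-7)/2`.  Then
`45 ∣ M_0 = rank`.  Proof: the binomial moments `Σ n_m C(m,5)`, `Σ n_m C(m,6)` are integers, and modulo the
recurrence `120·B₅ = 16M₀ - 32M₁`, `720·B₆ = 144M₁ - 16M₀`.  With `thetaComplex_rank45_moments` (rank `45`
attained) this pins the theta-realizable ranks in `P_α` on a ppav 7-fold to `45ℤ` exactly; the card's rank `2`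
is excluded a second time. [folklore] -/
theorem thetaComplex_secant_rank_dvd_fortyfive (s : Finset ℤ) (n : ℤ → ℤ) (M : ℕ → ℤ)
    (hmom : ∀ i, i ≤ 6 → ∑ m ∈ s, n m * m ^ i = M i)
    (hrec : ∀ i, i ≤ 4 → M (i + 2) = M (i + 1) - 2 * M i) : (45 : ℤ) ∣ M 0 := by
  have h5 : (120 : ℤ) ∣ M 5 - 10 * M 4 + 35 * M 3 - 50 * M 2 + 24 * M 1 := by
    have hs : ∑ m ∈ s, n m * (m ^ 5 - 10 * m ^ 4 + 35 * m ^ 3 - 50 * m ^ 2 + 24 * m) =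
        (∑ m ∈ s, n m * m ^ 5) - 10 * (∑ m ∈ s, n m * m ^ 4) + 35 * (∑ m ∈ s, n m * m ^ 3) -
          50 * (∑ m ∈ s, n m * m ^ 2) + 24 * (∑ m ∈ s, n m * m ^ 1) := by
      rw [Finset.mul_sum, Finset.mul_sum, Finset.mul_sum, Finset.mul_sum, ← Finset.sum_sub_distrib,
        ← Finset.sum_add_distrib, ← Finset.sum_sub_distrib, ← Finset.sum_add_distrib]
      exact Finset.sum_congr rfl fun m _ => by ring
    have hd : (120 : ℤ) ∣ ∑ m ∈ s, n m * (m ^ 5 - 10 * m ^ 4 + 35 * m ^ 3 - 50 * m ^ 2 + 24 * m) :=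
      Finset.dvd_sum fun m _ => Dvd.dvd.mul_left (fallingFactorial_five_dvd m) _
    rwa [hs, hmom 5 (by norm_num), hmom 4 (by norm_num), hmom 3 (by norm_num), hmom 2 (by norm_num),
      hmom 1 (by norm_num)] at hd
  have h6 : (720 : ℤ) ∣ M 6 - 15 * M 5 + 85 * M 4 - 225 * M 3 + 274 * M 2 - 120 * M 1 := by
    have hs : ∑ m ∈ s, n m * (m ^ 6 - 15 * m ^ 5 + 85 * m ^ 4 - 225 * m ^ 3 + 274 * m ^ 2 - 120 * m) =
        (∑ m ∈ s, n m * m ^ 6) - 15 * (∑ m ∈ s, n m * m ^ 5) + 85 * (∑ m ∈ s, n m * m ^ 4) -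
          225 * (∑ m ∈ s, n m * m ^ 3) + 274 * (∑ m ∈ s, n m * m ^ 2) - 120 * (∑ m ∈ s, n m * m ^ 1) := by
      rw [Finset.mul_sum, Finset.mul_sum, Finset.mul_sum, Finset.mul_sum, Finset.mul_sum,
        ← Finset.sum_sub_distrib, ← Finset.sum_add_distrib, ← Finset.sum_sub_distrib, ← Finset.sum_add_distrib,
        ← Finset.sum_sub_distrib]
      exact Finset.sum_congr rfl fun m _ => by ring
    have hd : (720 : ℤ) ∣ ∑ m ∈ s, n m * (m ^ 6 - 15 * m ^ 5 + 85 * m ^ 4 - 225 * m ^ 3 + 274 * m ^ 2 - 120 * m) :=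
      Finset.dvd_sum fun m _ => Dvd.dvd.mul_left (fallingFactorial_six_dvd m) _
    rwa [hs, hmom 6 (by norm_num), hmom 5 (by norm_num), hmom 4 (by norm_num), hmom 3 (by norm_num),
      hmom 2 (by norm_num), hmom 1 (by norm_num)] at hd
  have r0 := hrec 0 (by norm_num)
  have r1 := hrec 1 (by norm_num)
  have r2 := hrec 2 (by norm_num)
  have r3 := hrec 3 (by norm_num)
  have r4 := hrec 4 (by norm_num)
  simp only [zero_add] at r0
  norm_num at r1 r2 r3 r4
  omega

/-- The same in dimension `≥ 4` (moments up to `4`): `3 ∣ rank`. [folklore] -/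
theorem thetaComplex_secant_rank_dvd_three (s : Finset ℤ) (n : ℤ → ℤ) (M : ℕ → ℤ)
    (hmom : ∀ i, i ≤ 4 → ∑ m ∈ s, n m * m ^ i = M i)
    (hrec : ∀ i, i ≤ 2 → M (i + 2) = M (i + 1) - 2 * M i) : (3 : ℤ) ∣ M 0 := by
  have h3 : (6 : ℤ) ∣ M 3 - 3 * M 2 + 2 * M 1 := by
    have hs : ∑ m ∈ s, n m * (m ^ 3 - 3 * m ^ 2 + 2 * m) =
        (∑ m ∈ s, n m * m ^ 3) - 3 * (∑ m ∈ s, n m * m ^ 2) + 2 * (∑ m ∈ s, n m * m ^ 1) := by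
      rw [Finset.mul_sum, Finset.mul_sum, ← Finset.sum_sub_distrib, ← Finset.sum_add_distrib]
      exact Finset.sum_congr rfl fun m _ => by ring
    have hd : (6 : ℤ) ∣ ∑ m ∈ s, n m * (m ^ 3 - 3 * m ^ 2 + 2 * m) := by
      refine Finset.dvd_sum fun m _ => Dvd.dvd.mul_left ?_ _
      have h : ∀ x : ZMod 6, x ^ 3 - 3 * x ^ 2 + 2 * x = 0 := by decide
      have h' : ((m ^ 3 - 3 * m ^ 2 + 2 * m : ℤ) : ZMod 6) = 0 := by push_cast; exact h m
      exact_mod_cast (ZMod.intCast_zmod_eq_zero_iff_dvd _ 6).1 h'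
    rwa [hs, hmom 3 (by norm_num), hmom 2 (by norm_num), hmom 1 (by norm_num)] at hd
  have h4 : (24 : ℤ) ∣ M 4 - 6 * M 3 + 11 * M 2 - 6 * M 1 := by
    have hs : ∑ m ∈ s, n m * (m ^ 4 - 6 * m ^ 3 + 11 * m ^ 2 - 6 * m) =
        (∑ m ∈ s, n m * m ^ 4) - 6 * (∑ m ∈ s, n m * m ^ 3) + 11 * (∑ m ∈ s, n m * m ^ 2) -
          6 * (∑ m ∈ s, n m * m ^ 1) := by
      rw [Finset.mul_sum, Finset.mul_sum, Finset.mul_sum, ← Finset.sum_sub_distrib,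
        ← Finset.sum_add_distrib, ← Finset.sum_sub_distrib]
      exact Finset.sum_congr rfl fun m _ => by ring
    have hd : (24 : ℤ) ∣ ∑ m ∈ s, n m * (m ^ 4 - 6 * m ^ 3 + 11 * m ^ 2 - 6 * m) := by
      refine Finset.dvd_sum fun m _ => Dvd.dvd.mul_left ?_ _
      have h : ∀ x : ZMod 24, x ^ 4 - 6 * x ^ 3 + 11 * x ^ 2 - 6 * x = 0 := by decide
      have h' : ((m ^ 4 - 6 * m ^ 3 + 11 * m ^ 2 - 6 * m : ℤ) : ZMod 24) = 0 := by push_cast; exact h m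
      exact_mod_cast (ZMod.intCast_zmod_eq_zero_iff_dvd _ 24).1 h'
    rwa [hs, hmom 4 (by norm_num), hmom 3 (by norm_num), hmom 2 (by norm_num), hmom 1 (by norm_num)] at hd
  have r0 := hrec 0 (by norm_num)
  have r1 := hrec 1 (by norm_num)
  have r2 := hrec 2 (by norm_num)
  simp only [zero_add] at r0
  norm_num at r1 r2
  omega


end AmnesicMoments

end Summit.HodgeConjecture.HodgeConjecture.Theorems.WeilTwelvefoldsSqrtMinus7.Negative
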